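import Mathlib
import Summits.Ventures.PercRepro.TriangleCapThirdBandWitnessesB
import Summits.Ventures.PercRepro.TriangleCapLayers

/-!
# PercRepro — THE TOP FOURTEEN VALUES OF THE `K₄⁻`-FREE CHERRY TABLE: THE FIRST THREE LAYERS (p3, gen 50; part 222)

On the `a`-bipartite class the gap to the closed form is the pair count of the missing graph, and the spectrum down
to the `Δ = r − 3` layer (`pair_count_spectrum_three`, `r ≥ 15`) puts it at `0`, `2 (r − 2) + 2 j` (`j ≤ 1`),
`4 (r − 3) + 2 j` (`j ≤ 3`), `6 (r − 4) + 2 j` (`j ≤ 6`), or `≥ 8 (r − 5)` — `bipSub_gap_three_layers`.  Every one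
of the `1 + 2 + 4 + 7 = 14` listed values is attained on the cell for `a ≥ 4` (the star, the broom, the star plus a
disjoint pair, the four deletion families of the second band, the seven of the third band).  Hence
**`cherry_top_fourteen`** (`4 ≤ a`, `15 ≤ r`, `2 a + r ≤ k`, `8 (r − 5) ≤ stabGapFull k a r`): a `K₄⁻`-free graph
on the cell strictly within `8 (r − 5)` of the closed form sits at one of the fourteen values, and each is attained.

Axioms: standard.
-/

namespace PercRepro

namespace TriangleCap

namespace C047

open Finset

variable {V : Type*} [Fintype V] [DecidableEq V]

/-- **THE GAP OF A BIPARTITE GRAPH IS A VALUE OF THE FIRST THREE LAYERS OR BELOW** (`r ≥ 15`, `r + 1 ≤ k`). -/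
theorem bipSub_gap_three_layers (D : SimpleGraph V) [DecidableRel D.Adj] (A : Finset V) (hD : BipSub D A)
    (a r : ℕ) (hA : A.card = a) (hm : D.edgeFinset.card + r = a * (Fintype.card V - a)) (hr : 15 ≤ r)
    (hk : r + 1 ≤ Fintype.card V) :
    ∑ v, deg D v * deg D v + r * (Fintype.card V - 1 - r) = D.edgeFinset.card * Fintype.card V ∨
      (∃ j, j ≤ 1 ∧ ∑ v, deg D v * deg D v + r * (Fintype.card V - 1 - r) + (2 * (r - 2) + 2 * j) =
        D.edgeFinset.card * Fintype.card V) ∨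
      (∃ j, j ≤ 3 ∧ ∑ v, deg D v * deg D v + r * (Fintype.card V - 1 - r) + (4 * (r - 3) + 2 * j) =
        D.edgeFinset.card * Fintype.card V) ∨
      (∃ j, j ≤ 6 ∧ ∑ v, deg D v * deg D v + r * (Fintype.card V - 1 - r) + (6 * (r - 4) + 2 * j) =
        D.edgeFinset.card * Fintype.card V) ∨
      ∑ v, deg D v * deg D v + r * (Fintype.card V - 1 - r) + 8 * (r - 5) ≤
        D.edgeFinset.card * Fintype.card V := by
  have hH := bipSub_sum_deg_sq_add_disjEdgePairs D A hD a r hA hm hk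
  have hr' : (missingGraph D A).edgeFinset.card = r := card_edges_missingGraph D A hD a r hA hm
  have hid := sum_deg_sq_add_disjEdgePairs (missingGraph D A)
  rw [hr'] at hid
  have hfree := cliqueFree_of_bipSub _ A (bipSub_missingGraph D A)
  rcases pair_count_spectrum_three (missingGraph D A) hfree r hr hr' with h | ⟨j, hj, h⟩ | ⟨j, hj, h⟩ |
    ⟨j, hj, h⟩ | h
  · left; omega
  · right; left; exact ⟨j, hj, by omega⟩
  · right; right; left; exact ⟨j, hj, by omega⟩
  · right; right; right; left; exact ⟨j, hj, by omega⟩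
  · right; right; right; right; omega

/-- **THE TOP FOURTEEN VALUES OF THE CHERRY TABLE:** on every cell `(k, a, r)` with `4 ≤ a`, `15 ≤ r`, `2 a + r ≤ k`
and `8 (r − 5) ≤ stabGapFull k a r`, a `K₄⁻`-free graph with `a (k − a) − r` edges strictly within `8 (r − 5)` of the
closed form sits at one of the fourteen values `closed − g`, `g ∈ {0, 2 (r − 2), 2 (r − 1)} ∪ {4 (r − 3) + 2 j : j ≤ 3}
∪ {6 (r − 4) + 2 j : j ≤ 6}`, and each of the fourteen is attained. -/
theorem cherry_top_fourteen (k a r : ℕ) (ha4 : 4 ≤ a) (hr15 : 15 ≤ r) (hk : 2 * a + r ≤ k)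
    (hgap : 8 * (r - 5) ≤ stabGapFull k a r) :
    (∀ (D : SimpleGraph (Fin k)) [DecidableRel D.Adj], K4mFree D → D.edgeFinset.card + r = a * (k - a) →
        D.edgeFinset.card * k < ∑ v, deg D v * deg D v + r * (k - 1 - r) + 8 * (r - 5) →
        ∃ g ∈ ({0, 2 * (r - 2), 2 * (r - 1), 4 * (r - 3), 4 * (r - 3) + 2, 4 * (r - 3) + 4, 4 * (r - 3) + 6,
          6 * (r - 4), 6 * (r - 4) + 2, 6 * (r - 4) + 4, 6 * (r - 4) + 6, 6 * (r - 4) + 8, 6 * (r - 4) + 10,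
          6 * (r - 4) + 12} : Finset ℕ),
          ∑ v, deg D v * deg D v + r * (k - 1 - r) + g = D.edgeFinset.card * k) ∧
      (∀ g ∈ ({0, 2 * (r - 2), 2 * (r - 1), 4 * (r - 3), 4 * (r - 3) + 2, 4 * (r - 3) + 4, 4 * (r - 3) + 6,
          6 * (r - 4), 6 * (r - 4) + 2, 6 * (r - 4) + 4, 6 * (r - 4) + 6, 6 * (r - 4) + 8, 6 * (r - 4) + 10,
          6 * (r - 4) + 12} : Finset ℕ),
        ∃ (D : SimpleGraph (Fin k)) (_ : DecidableRel D.Adj), K4mFree D ∧ D.edgeFinset.card + r = a * (k - a) ∧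
          ∑ v, deg D v * deg D v + r * (k - 1 - r) + g = D.edgeFinset.card * k) := by
  have hcard : Fintype.card (Fin k) = k := Fintype.card_fin k
  have hk3 : a = 3 → r + 7 ≤ k := fun h => by omega
  refine ⟨?_, ?_⟩
  · intro D _ hK hm hlt
    have hbip : ∃ A : Finset (Fin k), A.card = a ∧ BipSub D A := by
      by_contra hnb
      have h := (stab_table_rows_ge_three k a r (by omega) hk (by omega) hk3).1 D hK hm hnb
      omega
    obtain ⟨A, hA, hB⟩ := hbip
    have hl := bipSub_gap_three_layers D A hB a r hA (by rw [hcard]; exact hm) hr15 (by rw [hcard]; omega)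
    rw [hcard] at hl
    simp only [mem_insert, mem_singleton]
    rcases hl with h | ⟨j, hj, h⟩ | ⟨j, hj, h⟩ | ⟨j, hj, h⟩ | h
    · exact ⟨0, by simp, by rw [add_zero]; exact h⟩
    · interval_cases j
      · exact ⟨2 * (r - 2), by simp, by rw [mul_zero, add_zero] at h; exact h⟩
      · exact ⟨2 * (r - 1), by simp, by omega⟩
    · interval_cases j
      · exact ⟨4 * (r - 3), by simp, by rw [mul_zero, add_zero] at h; exact h⟩
      · exact ⟨4 * (r - 3) + 2, by simp, by omega⟩
      · exact ⟨4 * (r - 3) + 4, by simp, by omega⟩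
      · exact ⟨4 * (r - 3) + 6, by simp, by omega⟩
    · interval_cases j
      · exact ⟨6 * (r - 4), by simp, by rw [mul_zero, add_zero] at h; exact h⟩
      · exact ⟨6 * (r - 4) + 2, by simp, by omega⟩
      · exact ⟨6 * (r - 4) + 4, by simp, by omega⟩
      · exact ⟨6 * (r - 4) + 6, by simp, by omega⟩
      · exact ⟨6 * (r - 4) + 8, by simp, by omega⟩
      · exact ⟨6 * (r - 4) + 10, by simp, by omega⟩
      · exact ⟨6 * (r - 4) + 12, by simp, by omega⟩
    · omega
  · intro g hg
    simp only [mem_insert, mem_singleton] at hg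
    rcases hg with rfl | rfl | rfl | rfl | rfl | rfl | rfl | rfl | rfl | rfl | rfl | rfl | rfl | rfl
    · have hK := k4mFree_bipMinusStar k a r
      have hE := card_edges_bipMinusStar k a r (by omega) (by omega)
      have hS := sum_deg_sq_bipMinusStar k a r (by omega) (by omega) (by omega)
      rw [hcard] at hS
      exact ⟨bipMinusStar k a r, inferInstance, hK, hE, by rw [add_zero]; exact hS⟩
    · obtain ⟨D, inst, A, hK, -, -, -, hE, hS⟩ := broom_value k a r (by omega) (by omega) (by omega)
      have hE' : D.edgeFinset.card + r = a * (k - a) := by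
        have : r ≤ a * (k - a) := by
          have h2 : 1 * (k - a) ≤ a * (k - a) := Nat.mul_le_mul_right _ (by omega)
          omega
        omega
      refine ⟨D, inst, hK, hE', ?_⟩
      rw [hE]
      exact hS
    · obtain ⟨hK, hE, hS⟩ := starPlusPair_value k a r (by omega) (by omega) (by omega)
      exact ⟨starPlusPair k a r (by omega), inferInstance, hK, hE, hS⟩
    · obtain ⟨hK, hE, hS⟩ := twoPairsAtLeaf_value k a r (by omega) (by omega) (by omega) (by omega)
      exact ⟨twoPairsAtLeaf k a r (by omega) (by omega) (by omega), inferInstance, hK, hE, hS⟩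
    · obtain ⟨hK, hE, hS⟩ := twoPairsAtTwoLeaves_value k a r (by omega) (by omega) (by omega) (by omega)
      exact ⟨twoPairsAtTwoLeaves k a r (by omega) (by omega) (by omega) (by omega), inferInstance, hK, hE, hS⟩
    · obtain ⟨hK, hE, hS⟩ := pairAtLeafPlusPair_value k a r (by omega) (by omega) (by omega) (by omega)
      exact ⟨pairAtLeafPlusPair k a r (by omega) (by omega) (by omega), inferInstance, hK, hE, hS⟩
    · obtain ⟨hK, hE, hS⟩ := twoPairsOff_value k a r (by omega) (by omega) (by omega) (by omega)
      exact ⟨twoPairsOff k a r (by omega) (by omega), inferInstance, hK, hE, hS⟩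
    · obtain ⟨hK, hE, hS⟩ := threePairsAtVertex_value k a r (by omega) (by omega) (by omega) (by omega)
      exact ⟨threePairsAtVertex k a r (by omega) (by omega) (by omega) (by omega), inferInstance, hK, hE, hS⟩
    · obtain ⟨hK, hE, hS⟩ := threePairsPath_value k a r ha4 (by omega) (by omega) (by omega)
      exact ⟨threePairsPath k a r (by omega) (by omega) (by omega), inferInstance, hK, hE, hS⟩
    · obtain ⟨hK, hE, hS⟩ := twoPairsAtVertexPlusLeaf_value k a r ha4 (by omega) (by omega) (by omega)
      exact ⟨twoPairsAtVertexPlusLeaf k a r (by omega) (by omega) (by omega), inferInstance, hK, hE, hS⟩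
    · obtain ⟨hK, hE, hS⟩ := threePairsAtThreeLeaves_value k a r ha4 (by omega) (by omega) (by omega)
      exact ⟨threePairsAtThreeLeaves k a r (by omega) (by omega) (by omega) (by omega), inferInstance, hK, hE, hS⟩
    · obtain ⟨hK, hE, hS⟩ := twoLeavesPlusOff_value k a r ha4 (by omega) (by omega) (by omega)
      exact ⟨twoLeavesPlusOff k a r (by omega) (by omega) (by omega) (by omega), inferInstance, hK, hE, hS⟩
    · obtain ⟨hK, hE, hS⟩ := oneLeafPlusTwoOff_value k a r ha4 (by omega) (by omega) (by omega)
      exact ⟨oneLeafPlusTwoOff k a r (by omega) (by omega) (by omega) (by omega), inferInstance, hK, hE, hS⟩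
    · obtain ⟨hK, hE, hS⟩ := threePairsOff_value k a r ha4 (by omega) (by omega) (by omega)
      exact ⟨threePairsOff k a r (by omega) (by omega) (by omega), inferInstance, hK, hE, hS⟩

end C047

end TriangleCap

end PercRepro
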